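import Mathlib

/-!
# Crux `DisclinationRation.FiveFoldRation` (stmt-AtomisticToContinuum-15799), line `Sketch` —
# helpers for stub `stub_dr5_dichotomy` (square/fold-back dichotomy), part 2: the prism, abstractly

Two pattern-free ingredients of the dichotomy for the decahedral pattern (bicapped pentagonal
prism), both stated for an abstract set `P ⊆ ℝ³` of unit vectors:

* `dr5di_cycle_of_dicho` — the PARALLELOGRAM LAW for induced `4`-cycles of the adjacency
  `dist ≤ 26/25` follows from the square/fold-back dichotomy, `1`-separation and a spectral gap
  (`26/25 < dist ⟹ dist² ≥ 2`), by polarization: for unit vectors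
  `‖T₁ + T₃ - T₂ - T₄‖² = Σ sides² - Σ diagonals²` (`dr5di_polar4`) and
  `‖T + T' - Y‖² = 1 + d(Y,T)² + d(Y,T')² - d(T,T')²` (`dr5di_polar3`).
* `dr5di_dicho_abstract` — the SQUARE/FOLD-BACK DICHOTOMY for any `P` made of points `pole σ`,
  `ring k σ` (`σ = ±1/2`, `k : Fin 5`) with the adjacency structure, the distances
  (`pole–ring = 1`, `ring–ring² = 3/2·(1 - cos(2π(j-k)/5)) + (σ-τ)²`) and the rectangle apex
  identities of the prism: a case analysis over (pole | ring) × (the ≤ 4 neighbours)².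

Also the cosines of the fifth roots of unity (`dr5di_cos_vals`).  Helper prefix `dr5di_`; no
notations, no definitions.
-/

noncomputable section

namespace Summit.AtomisticToContinuum.Crystallization.Theorems

/-! ### Trigonometry and small index facts -/

/-- The cosines of the fifth roots of unity: `cos(2π/5) = cos(8π/5) = (√5-1)/4` and
`cos(4π/5) = cos(6π/5) = -(√5+1)/4`. -/
theorem dr5di_cos_vals :
    (∀ m : Fin 5, m = 1 ∨ m = 4 → Real.cos (2 * Real.pi * (m : ℝ) / 5) = (Real.sqrt 5 - 1) / 4) ∧
    (∀ m : Fin 5, m = 2 ∨ m = 3 →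
      Real.cos (2 * Real.pi * (m : ℝ) / 5) = -(Real.sqrt 5 + 1) / 4) := by
  have h5 : Real.sqrt 5 ^ 2 = 5 := Real.sq_sqrt (by norm_num)
  have c1 : Real.cos (2 * (Real.pi / 5)) = (Real.sqrt 5 - 1) / 4 := by
    rw [Real.cos_two_mul, Real.cos_pi_div_five]
    linear_combination (1 / 8 : ℝ) * h5
  constructor
  · rintro m (rfl | rfl)
    · have : 2 * Real.pi * ((1 : Fin 5) : ℝ) / 5 = 2 * (Real.pi / 5) := by norm_num; ring
      rw [this, c1]
    · have : 2 * Real.pi * ((4 : Fin 5) : ℝ) / 5 = -(2 * (Real.pi / 5)) + 2 * Real.pi := by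
        norm_num; ring
      rw [this, Real.cos_add_two_pi, Real.cos_neg, c1]
  · rintro m (rfl | rfl)
    · have : 2 * Real.pi * ((2 : Fin 5) : ℝ) / 5 = Real.pi - Real.pi / 5 := by
        norm_num; ring
      rw [this, Real.cos_pi_sub, Real.cos_pi_div_five]
      ring
    · have : 2 * Real.pi * ((3 : Fin 5) : ℝ) / 5 = Real.pi / 5 + Real.pi := by
        norm_num; ring
      rw [this, Real.cos_add_pi, Real.cos_pi_div_five]
      ring

/-- Every element of `Fin 5` is one of `0, …, 4`. -/
theorem dr5di_fin5_cases (m : Fin 5) : m = 0 ∨ m = 1 ∨ m = 2 ∨ m = 3 ∨ m = 4 := by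
  fin_cases m <;> simp

/-- Index identities in `Fin 5` used in the case analysis. -/
theorem dr5di_fin5_ids (k : Fin 5) :
    k - (k + 1) = 4 ∧ k - (k - 1) = 1 ∧ k + 1 - k = 1 ∧ k - 1 - k = 4 ∧ k + 1 - (k - 1) = 2 ∧
      k - 1 - (k + 1) = 3 := by
  revert k; decide

/-- Distance between two points of the axis. -/
theorem dr5di_axis_dist (a b : ℝ) :
    dist (!₂[(0 : ℝ), 0, a] : EuclideanSpace ℝ (Fin 3)) (!₂[(0 : ℝ), 0, b]) = |a - b| := by
  rw [EuclideanSpace.dist_eq, Fin.sum_univ_three]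
  simp [Real.dist_eq, Real.sqrt_sq_eq_abs]

/-! ### Polarization identities and the parallelogram law -/

/-- `dist ≤ 26/25` squared. -/
theorem dr5di_sq_le {x y : EuclideanSpace ℝ (Fin 3)} (h : dist x y ≤ 26 / 25) :
    dist x y ^ 2 ≤ 676 / 625 := by
  nlinarith [dist_nonneg (x := x) (y := y)]

/-- `26/25 < dist` squared. -/
theorem dr5di_lt_sq {x y : EuclideanSpace ℝ (Fin 3)} (h : 26 / 25 < dist x y) :
    676 / 625 < dist x y ^ 2 := by
  nlinarith [dist_nonneg (x := x) (y := y)]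

/-- Polarization for three unit vectors: `‖T + T' - Y‖² = 1 + d(Y,T)² + d(Y,T')² - d(T,T')²`. -/
theorem dr5di_polar3 {Y T T' : EuclideanSpace ℝ (Fin 3)} (hY : ‖Y‖ = 1) (hT : ‖T‖ = 1)
    (hT' : ‖T'‖ = 1) :
    ‖T + T' - Y‖ ^ 2 = 1 + dist Y T ^ 2 + dist Y T' ^ 2 - dist T T' ^ 2 := by
  have h1 := norm_sub_sq_real (T + T') Y
  have h2 := norm_add_sq_real T T'
  have h3 := norm_sub_sq_real Y T
  have h4 := norm_sub_sq_real Y T'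
  have h5 := norm_sub_sq_real T T'
  rw [inner_add_left] at h1
  simp only [dist_eq_norm]
  rw [hY, hT] at h3
  rw [hY, hT'] at h4
  rw [hT, hT'] at h2 h5
  rw [hY] at h1
  linarith [real_inner_comm Y T, real_inner_comm Y T']

/-- Polarization for four unit vectors:
`‖T₁ + T₃ - T₂ - T₄‖² = d₁₂² + d₁₄² + d₃₂² + d₃₄² - d₁₃² - d₂₄²`. -/
theorem dr5di_polar4 {T₁ T₂ T₃ T₄ : EuclideanSpace ℝ (Fin 3)} (h₁ : ‖T₁‖ = 1) (h₂ : ‖T₂‖ = 1)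
    (h₃ : ‖T₃‖ = 1) (h₄ : ‖T₄‖ = 1) :
    ‖T₁ + T₃ - T₂ - T₄‖ ^ 2 = dist T₁ T₂ ^ 2 + dist T₁ T₄ ^ 2 + dist T₃ T₂ ^ 2 + dist T₃ T₄ ^ 2 -
      dist T₁ T₃ ^ 2 - dist T₂ T₄ ^ 2 := by
  have e : T₁ + T₃ - T₂ - T₄ = (T₁ + T₃) - (T₂ + T₄) := by abel
  have h0 := norm_sub_sq_real (T₁ + T₃) (T₂ + T₄)
  have ha := norm_add_sq_real T₁ T₃
  have hb := norm_add_sq_real T₂ T₄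
  have h12 := norm_sub_sq_real T₁ T₂
  have h14 := norm_sub_sq_real T₁ T₄
  have h32 := norm_sub_sq_real T₃ T₂
  have h34 := norm_sub_sq_real T₃ T₄
  have h13 := norm_sub_sq_real T₁ T₃
  have h24 := norm_sub_sq_real T₂ T₄
  rw [inner_add_left, inner_add_right, inner_add_right] at h0
  simp only [dist_eq_norm]
  rw [e]
  rw [h₁, h₃] at ha h13
  rw [h₂, h₄] at hb h24
  rw [h₁, h₂] at h12
  rw [h₁, h₄] at h14
  rw [h₃, h₂] at h32
  rw [h₃, h₄] at h34
  linarith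

/-- **Parallelogram law for induced `4`-cycles, from the dichotomy.** For a `1`-separated set `P`
of unit vectors whose non-adjacent pairs (`26/25 < dist`) are at squared distance `≥ 2` and which
satisfies the square/fold-back dichotomy, every induced `4`-cycle of the adjacency `dist ≤ 26/25`
is a parallelogram. (A square corner `T₁` gives `X = T₂ + T₄ - T₁ ∈ P` with
`dist(X, T₃)² = Σ sides² - Σ diagonals² < 1`, so `X = T₃`; two fold-back corners force
`Σ diagonals² > Σ sides²`, impossible.) -/
theorem dr5di_cycle_of_dicho {P : Set (EuclideanSpace ℝ (Fin 3))} (hnorm : ∀ x ∈ P, ‖x‖ = 1)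
    (hsep : ∀ x ∈ P, ∀ y ∈ P, x ≠ y → 1 ≤ dist x y)
    (hgap : ∀ x ∈ P, ∀ y ∈ P, 26 / 25 < dist x y → 2 ≤ dist x y ^ 2)
    (hdich : ∀ Y ∈ P, ∀ T ∈ P, ∀ T' ∈ P, dist Y T ≤ 26 / 25 → dist Y T' ≤ 26 / 25 → T ≠ T' →
      26 / 25 < dist T T' → ((T + T' - Y ∈ P ∧ dist T T' ≤ 3 / 2) ∨ ‖T + T' - Y‖ ≤ 61 / 100)) :
    ∀ T₁ ∈ P, ∀ T₂ ∈ P, ∀ T₃ ∈ P, ∀ T₄ ∈ P, dist T₁ T₂ ≤ 26 / 25 → dist T₂ T₃ ≤ 26 / 25 →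
      dist T₃ T₄ ≤ 26 / 25 → dist T₄ T₁ ≤ 26 / 25 → 26 / 25 < dist T₁ T₃ → 26 / 25 < dist T₂ T₄ →
        T₁ + T₃ = T₂ + T₄ := by
  intro T₁ h₁ T₂ h₂ T₃ h₃ T₄ h₄ h12 h23 h34 h41 h13 h24
  have n13 : T₁ ≠ T₃ := fun h => by rw [h, dist_self] at h13; norm_num at h13
  have n24 : T₂ ≠ T₄ := fun h => by rw [h, dist_self] at h24; norm_num at h24
  have s12 := dr5di_sq_le h12
  have s23 := dr5di_sq_le h23
  have s34 := dr5di_sq_le h34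
  have s41 := dr5di_sq_le h41
  have g13 := hgap _ h₁ _ h₃ h13
  have g24 := hgap _ h₂ _ h₄ h24
  have P4 := dr5di_polar4 (hnorm _ h₁) (hnorm _ h₂) (hnorm _ h₃) (hnorm _ h₄)
  rw [dist_comm T₁ T₄, dist_comm T₃ T₂] at P4
  -- a square corner closes the cycle
  rcases hdich T₁ h₁ T₂ h₂ T₄ h₄ h12 (by rwa [dist_comm] at h41) n24 h24 with ⟨hX, -⟩ | hf₁
  · by_contra hne
    have hX3 : T₂ + T₄ - T₁ ≠ T₃ := fun h => hne (by rw [← h]; abel)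
    have hs := one_le_pow₀ (M₀ := ℝ) (hsep _ hX _ h₃ hX3) (n := 2)
    have he : dist (T₂ + T₄ - T₁) T₃ = ‖T₁ + T₃ - T₂ - T₄‖ := by
      rw [dist_eq_norm, ← norm_neg]; congr 1; abel
    rw [he] at hs
    linarith
  rcases hdich T₂ h₂ T₁ h₁ T₃ h₃ (by rwa [dist_comm] at h12) h23 n13 h13 with ⟨hX, -⟩ | hf₂
  · by_contra hne
    have hX4 : T₁ + T₃ - T₂ ≠ T₄ := fun h => hne (by rw [← h]; abel)
    have hs := one_le_pow₀ (M₀ := ℝ) (hsep _ hX _ h₄ hX4) (n := 2)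
    have he : dist (T₁ + T₃ - T₂) T₄ = ‖T₁ + T₃ - T₂ - T₄‖ := by rw [dist_eq_norm]
    rw [he] at hs
    linarith
  -- two fold-back corners are impossible
  exfalso
  have P₁ := dr5di_polar3 (hnorm _ h₁) (hnorm _ h₂) (hnorm _ h₄)
  have P₂ := dr5di_polar3 (hnorm _ h₂) (hnorm _ h₁) (hnorm _ h₃)
  rw [dist_comm T₂ T₁] at P₂
  have f₁ := pow_le_pow_left₀ (norm_nonneg _) hf₁ 2
  have f₂ := pow_le_pow_left₀ (norm_nonneg _) hf₂ 2
  have n12 : T₁ ≠ T₂ := fun h => by rw [h] at h13; exact absurd h23 (not_le.2 h13)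
  have n14 : T₁ ≠ T₄ := fun h => by rw [h, dist_comm] at h13; exact absurd h34 (not_le.2 h13)
  have n23 : T₂ ≠ T₃ := fun h => by rw [← h] at h13; exact absurd h12 (not_le.2 h13)
  have l12 := one_le_pow₀ (M₀ := ℝ) (hsep _ h₁ _ h₂ n12) (n := 2)
  have l14 := one_le_pow₀ (M₀ := ℝ) (hsep _ h₁ _ h₄ n14) (n := 2)
  have l23 := one_le_pow₀ (M₀ := ℝ) (hsep _ h₂ _ h₃ n23) (n := 2)
  have h0 := sq_nonneg ‖T₁ + T₃ - T₂ - T₄‖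
  norm_num at f₁ f₂
  linarith

/-! ### The dichotomy for an abstract bicapped pentagonal prism -/

/-- **Abstract square/fold-back dichotomy for a bicapped pentagonal prism.** If `P` consists of
unit vectors `pole σ` and `ring k σ` (`σ = ±1/2`, `k : Fin 5`) with the adjacency structure and
the distances of the decahedral pattern (pole–ring `1`, ring–ring
`3/2·(1 - c(j-k)) + (σ-τ)²` with `c` the cosines of the fifth roots of unity) and the rectangle
apex identities, then two distinct non-adjacent neighbours `T, T'` of `Y ∈ P` either span a
rectangle (`T + T' - Y ∈ P`, `dist T T' ≤ 3/2`) or fold back (`‖T + T' - Y‖ ≤ 61/100`). -/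
theorem dr5di_dicho_abstract {P : Set (EuclideanSpace ℝ (Fin 3))}
    {pole : ℝ → EuclideanSpace ℝ (Fin 3)} {ring : Fin 5 → ℝ → EuclideanSpace ℝ (Fin 3)}
    {c : Fin 5 → ℝ}
    (hmem : ∀ x ∈ P, ∃ σ : ℝ, (σ = 1 / 2 ∨ σ = -(1 / 2)) ∧ (x = pole σ ∨ ∃ k, x = ring k σ))
    (hringP : ∀ (k : Fin 5) (σ : ℝ), (σ = 1 / 2 ∨ σ = -(1 / 2)) → ring k σ ∈ P)
    (hnorm : ∀ x ∈ P, ‖x‖ = 1)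
    (hadjP : ∀ σ : ℝ, (σ = 1 / 2 ∨ σ = -(1 / 2)) → ∀ x ∈ P, dist (pole σ) x ≤ 26 / 25 →
      x = pole σ ∨ ∃ k, x = ring k σ)
    (hadjR : ∀ (k : Fin 5) (σ : ℝ), (σ = 1 / 2 ∨ σ = -(1 / 2)) → ∀ x ∈ P,
      dist (ring k σ) x ≤ 26 / 25 →
        x = ring k σ ∨ x = pole σ ∨ x = ring k (-σ) ∨ x = ring (k + 1) σ ∨ x = ring (k - 1) σ)
    (hPR : ∀ (k : Fin 5) (σ : ℝ), (σ = 1 / 2 ∨ σ = -(1 / 2)) → dist (pole σ) (ring k σ) = 1)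
    (hPR' : ∀ (k : Fin 5) (σ : ℝ), (σ = 1 / 2 ∨ σ = -(1 / 2)) →
      dist (pole σ) (ring k (-σ)) ^ 2 = 3)
    (hRR : ∀ (j k : Fin 5) (σ τ : ℝ),
      dist (ring j σ) (ring k τ) ^ 2 = 3 / 2 * (1 - c (j - k)) + (σ - τ) ^ 2)
    (hc0 : c 0 = 1) (hc14 : ∀ m : Fin 5, m = 1 ∨ m = 4 → c m = (Real.sqrt 5 - 1) / 4)
    (hc23 : ∀ m : Fin 5, m = 2 ∨ m = 3 → c m = -(Real.sqrt 5 + 1) / 4)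
    (hapex : ∀ (k : Fin 5) (σ : ℝ), ring k (-σ) + ring (k + 1) σ - ring k σ = ring (k + 1) (-σ) ∧
      ring k (-σ) + ring (k - 1) σ - ring k σ = ring (k - 1) (-σ)) :
    ∀ Y ∈ P, ∀ T ∈ P, ∀ T' ∈ P, dist Y T ≤ 26 / 25 → dist Y T' ≤ 26 / 25 → T ≠ T' →
      26 / 25 < dist T T' → ((T + T' - Y ∈ P ∧ dist T T' ≤ 3 / 2) ∨ ‖T + T' - Y‖ ≤ 61 / 100) := by
  have h5lo : (2236 : ℝ) / 1000 < Real.sqrt 5 := by rw [Real.lt_sqrt (by norm_num)]; norm_num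
  have h5hi : Real.sqrt 5 < 2237 / 1000 := by rw [Real.sqrt_lt' (by norm_num)]; norm_num
  -- two distinct non-adjacent ring points of the same height are far apart
  have hsame : ∀ (j k : Fin 5) (σ : ℝ), ring j σ ≠ ring k σ →
      26 / 25 < dist (ring j σ) (ring k σ) →
        (15 + 3 * Real.sqrt 5) / 8 ≤ dist (ring j σ) (ring k σ) ^ 2 := by
    intro j k σ hne hlt
    have h := hRR j k σ σ
    rw [sub_self, zero_pow two_ne_zero, add_zero] at h
    have hlt2 := dr5di_lt_sq hlt
    rcases dr5di_fin5_cases (j - k) with e | e | e | e | e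
    · exact absurd (by rw [sub_eq_zero.1 e]) hne
    · rw [e, hc14 1 (Or.inl rfl)] at h; linarith
    · rw [e, hc23 2 (Or.inl rfl)] at h; linarith
    · rw [e, hc23 3 (Or.inr rfl)] at h; linarith
    · rw [e, hc14 4 (Or.inr rfl)] at h; linarith
  intro Y hY T hT T' hT' hYT hYT' hne hTT'
  have P3 := dr5di_polar3 (hnorm Y hY) (hnorm T hT) (hnorm T' hT')
  -- the fold-back criterion
  have fold : 6279 / 10000 + dist Y T ^ 2 + dist Y T' ^ 2 ≤ dist T T' ^ 2 →
      (T + T' - Y ∈ P ∧ dist T T' ≤ 3 / 2) ∨ ‖T + T' - Y‖ ≤ 61 / 100 := by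
    intro h
    right
    have h2 : ‖T + T' - Y‖ ^ 2 ≤ (61 / 100) ^ 2 := by rw [P3]; linarith
    exact le_of_pow_le_pow_left₀ two_ne_zero (by norm_num) h2
  -- the rectangle-diagonal bound
  have diag : dist T T' ^ 2 = 3 / 2 * (1 - (Real.sqrt 5 - 1) / 4) + 1 → dist T T' ≤ 3 / 2 := by
    intro h
    have h2 : dist T T' ^ 2 ≤ (3 / 2) ^ 2 := by rw [h]; linarith
    exact le_of_pow_le_pow_left₀ two_ne_zero (by norm_num) h2
  obtain ⟨σ, hσ, hYc⟩ := hmem Y hY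
  have hσ' : -σ = 1 / 2 ∨ -σ = -(1 / 2) := by rcases hσ with rfl | rfl <;> norm_num
  have h2σ : (σ - -σ) ^ 2 = 1 ∧ (-σ - σ) ^ 2 = 1 := by rcases hσ with rfl | rfl <;> norm_num
  rcases hYc with rfl | ⟨k₀, rfl⟩
  · -- `Y` is a pole: `T, T'` are ring points of its side, distinct and non-adjacent, hence far
    rcases hadjP σ hσ T hT hYT with rfl | ⟨k₁, rfl⟩
    · exact absurd hYT' (not_le.2 hTT')
    rcases hadjP σ hσ T' hT' hYT' with rfl | ⟨k₂, rfl⟩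
    · rw [dist_comm, hPR k₁ σ hσ] at hTT'; norm_num at hTT'
    apply fold
    rw [hPR k₁ σ hσ, hPR k₂ σ hσ]
    have := hsame k₁ k₂ σ hne hTT'
    linarith
  · -- `Y = ring k₀ σ`: `T, T'` are among the pole, the partner and the two ring-mates
    obtain ⟨i1, i2, i3, i4, i5, i6⟩ := dr5di_fin5_ids k₀
    have dP : dist (ring k₀ σ) (pole σ) ^ 2 = 1 := by rw [dist_comm, hPR k₀ σ hσ]; norm_num
    have dQ : dist (ring k₀ σ) (ring k₀ (-σ)) ^ 2 = 1 := by
      rw [hRR, sub_self, hc0, h2σ.1]; norm_num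
    have dM1 : dist (ring k₀ σ) (ring (k₀ + 1) σ) ^ 2 = 3 / 2 * (1 - (Real.sqrt 5 - 1) / 4) := by
      rw [hRR, i1, hc14 4 (Or.inr rfl), sub_self, zero_pow two_ne_zero, add_zero]
    have dM2 : dist (ring k₀ σ) (ring (k₀ - 1) σ) ^ 2 = 3 / 2 * (1 - (Real.sqrt 5 - 1) / 4) := by
      rw [hRR, i2, hc14 1 (Or.inl rfl), sub_self, zero_pow two_ne_zero, add_zero]
    have dQM1 : dist (ring k₀ (-σ)) (ring (k₀ + 1) σ) ^ 2 =
        3 / 2 * (1 - (Real.sqrt 5 - 1) / 4) + 1 := by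
      rw [hRR, i1, hc14 4 (Or.inr rfl), h2σ.2]
    have dQM2 : dist (ring k₀ (-σ)) (ring (k₀ - 1) σ) ^ 2 =
        3 / 2 * (1 - (Real.sqrt 5 - 1) / 4) + 1 := by
      rw [hRR, i2, hc14 1 (Or.inl rfl), h2σ.2]
    have dMM : dist (ring (k₀ + 1) σ) (ring (k₀ - 1) σ) ^ 2 =
        3 / 2 * (1 - -(Real.sqrt 5 + 1) / 4) := by
      rw [hRR, i5, hc23 2 (Or.inl rfl), sub_self, zero_pow two_ne_zero, add_zero]
    rcases hadjR k₀ σ hσ T hT hYT with rfl | rfl | rfl | rfl | rfl <;>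
      rcases hadjR k₀ σ hσ T' hT' hYT' with rfl | rfl | rfl | rfl | rfl
    -- `T = Y`
    · exact absurd rfl hne
    · exact absurd hYT' (not_le.2 hTT')
    · exact absurd hYT' (not_le.2 hTT')
    · exact absurd hYT' (not_le.2 hTT')
    · exact absurd hYT' (not_le.2 hTT')
    -- `T` the pole
    · rw [dist_comm] at hTT'; exact absurd hYT (not_le.2 hTT')
    · exact absurd rfl hne
    · apply fold; rw [dP, dQ, hPR' k₀ σ hσ]; norm_num
    · rw [hPR _ σ hσ] at hTT'; norm_num at hTT'
    · rw [hPR _ σ hσ] at hTT'; norm_num at hTT'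
    -- `T` the partner
    · rw [dist_comm] at hTT'; exact absurd hYT (not_le.2 hTT')
    · apply fold; rw [dQ, dP, dist_comm, hPR' k₀ σ hσ]; norm_num
    · exact absurd rfl hne
    · exact Or.inl ⟨by rw [(hapex k₀ σ).1]; exact hringP _ _ hσ', diag dQM1⟩
    · exact Or.inl ⟨by rw [(hapex k₀ σ).2]; exact hringP _ _ hσ', diag dQM2⟩
    -- `T` the ring-mate `k₀ + 1`
    · rw [dist_comm] at hTT'; exact absurd hYT (not_le.2 hTT')
    · rw [dist_comm, hPR _ σ hσ] at hTT'; norm_num at hTT'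
    · refine Or.inl ⟨by rw [add_comm, (hapex k₀ σ).1]; exact hringP _ _ hσ', diag ?_⟩
      rw [dist_comm, dQM1]
    · exact absurd rfl hne
    · apply fold; rw [dM1, dM2, dMM]; linarith
    -- `T` the ring-mate `k₀ - 1`
    · rw [dist_comm] at hTT'; exact absurd hYT (not_le.2 hTT')
    · rw [dist_comm, hPR _ σ hσ] at hTT'; norm_num at hTT'
    · refine Or.inl ⟨by rw [add_comm, (hapex k₀ σ).2]; exact hringP _ _ hσ', diag ?_⟩
      rw [dist_comm, dQM2]
    · apply fold; rw [dM2, dM1, dist_comm, dMM]; linarith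
    · exact absurd rfl hne

end Summit.AtomisticToContinuum.Crystallization.Theorems

end
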